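import Literature.Topology.Euclidean.CoerciveFieldIndex
import Summits.SmoothPoincare4.SmoothPoincare4.Theorems.SullivanDualWitnessChargeKroneckerRegularValue
import Summits.SmoothPoincare4.SmoothPoincare4.Theorems.SullivanDualWitnessChargeKroneckerFiniteZeros

/-!
# Comparison of signed zero counts (Kronecker existence theorem, step K5)

Crux `WitnessCharge` (stmt-SmoothPoincare4-7824), route `SullivanDual`, line Sketch. The F5
programme (McDuff's cusp theorem via the twisted difference map of a `J`-holomorphic curve) uses a
Kronecker existence theorem on sup-norm cubes of `ℝⁿ⁺¹` (`Fin (n + 1) → ℝ`, `‖x‖ = maxᵢ |xᵢ|`).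
This file is its heart: if two `C¹` fields `G₁, G₂` agree wherever `‖x‖ ≥ ρ₁`, `G₂` has no zero
in the closed cube `‖x‖ ≤ ρ₁`, and the zeros of `G₁` in that cube are non-degenerate, then the
signed count `∑ sign det DG₁(z)` over the zeros `z` of `G₁` in the open cube vanishes
(`helper_kronecker_compare`; in degree language `deg(G₁, cube, 0) = deg(G₂, cube, 0) = 0`).

## Proof (reduction to the flat torus)

As in `Literature.Topology.Euclidean.sum_sign_det_eq_one_of_coercive` we glue both fields to the
`T`-periodic sine field `S` (`T = 4ρ₃`): with a product cutoff `χ` (`= 1` on the cube `ρ₂`,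
supported in the open cube `ρ₃ = ρ₂ + 1`) put `gᵢ = χ · (Gᵢ - S)` and `Hᵢ = S + periodise gᵢ`,
a `C¹` periodic field equal to `Gᵢ` on the cube `ρ₂` of the period cell. Here `ρ₂ > ρ₁` is chosen
so that `‖G₂‖ ≥ m > 0` on the cube `ρ₂` (compactness). The zeros of `Hᵢ` far from the small cube
may be degenerate, so we shift: by Sard (`helper_kronecker_regularValue`) there is `c`, `‖c‖ < m`,
which is a regular value of `H₁` and `H₂` on the compact collar-to-cell region
`K = {ρ₂ ≤ ‖x‖ ≤ T/2}`, and we apply the torus index theorem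
`Literature.Topology.Euclidean.sum_sign_det_eq_zero_of_periodic` to the periodic `C¹` fields
`fᵢ = Hᵢ - (1 - periodise χ₂) • c`, where the second cutoff `χ₂` is `1` on the cube `ρ₁` and
supported in the open cube `ρ₂`. In the cell: on the cube `ρ₁`, `fᵢ = Gᵢ` (zeros of `f₁`: the
given finset `S`, with the same derivative; zeros of `f₂`: none); on the collar
`ρ₁ ≤ ‖x‖ ≤ ρ₂`, `fᵢ = G₂ - (1 - χ₂) • c ≠ 0` as `‖c‖ < m ≤ ‖G₂‖`; outside the cube `ρ₂`,
`fᵢ = Hᵢ - c` and `H₁ = H₂` there (even on a neighbourhood of each such point of the cell), so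
`f₁` and `f₂` have the same zeros there — a finite set by `helper_kronecker_finiteZeros`,
non-degenerate by the choice of `c` — with the same derivatives. Subtracting the two torus
identities leaves `∑_{z ∈ S} sign det DG₁(z) = 0`.

`Literature/Topology/Euclidean/{PoincareHopfTorus,CoerciveFieldIndex}.lean`, the sibling steps
K2 (`helper_kronecker_regularValue`) and K3 (`helper_kronecker_finiteZeros`), Mathlib; no
definitions, no `sorry`.
-/

noncomputable section

-- the summit path `SmoothPoincare4/SmoothPoincare4` forces a duplicated namespace segment
set_option linter.dupNamespace false

open Set Function Metric Filter Real Finset Literature.Topology.Euclidean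
open scoped Topology BigOperators

namespace Summit.SmoothPoincare4.SmoothPoincare4.Theorems.WitnessCharge.PencilIncompleteness

/-- Distance to the lattice `Tℤ` near a point of the closed period cell: if `|u| ≤ T/2`,
`a < |u|` and `|v - u| < |u| - a`, then `|v - Tm| ≥ a` for every integer `m`. -/
private lemma le_abs_sub_mul_int {T a u v : ℝ} (hT : 0 < T) (hu : |u| ≤ T / 2)
    (hv : |v - u| < |u| - a) (m : ℤ) : a ≤ |v - T * m| := by
  have h4 : |v| - |u| ≤ |v - u| := abs_sub_abs_le_abs_sub v u
  rcases eq_or_ne m 0 with rfl | hm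
  · simp only [Int.cast_zero, mul_zero, sub_zero]
    have h5 : |u| - |v| ≤ |u - v| := abs_sub_abs_le_abs_sub u v
    rw [abs_sub_comm] at h5
    linarith
  · have h1 : (1 : ℝ) ≤ |(m : ℝ)| := by exact_mod_cast Int.one_le_abs hm
    have h2 : T ≤ |T * m| := by
      rw [abs_mul, abs_of_pos hT]
      nlinarith
    have h3 : |T * m| - |v| ≤ |v - T * m| := by
      rw [abs_sub_comm v]
      exact abs_sub_abs_le_abs_sub _ _
    linarith

/-- Near a point `x` of the closed period cell (`‖x‖ ≤ T/2`) outside the cube `‖·‖ ≤ a`, every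
point has a coordinate at distance `≥ a` from the lattice `Tℤ`. -/
private lemma eventually_far {n : ℕ} {T a : ℝ} (hT : 0 < T) (ha : 0 ≤ a) {x : Fin (n + 1) → ℝ}
    (hxT : ‖x‖ ≤ T / 2) (hxa : a < ‖x‖) :
    ∀ᶠ y in 𝓝 x, ∃ i, ∀ m : ℤ, a ≤ |y i - T * m| := by
  obtain ⟨i, hi⟩ : ∃ i, a < |x i| := by
    by_contra h
    push Not at h
    have : ‖x‖ ≤ a := (pi_norm_le_iff_of_nonneg ha).2 fun i => by
      rw [Real.norm_eq_abs]; exact h i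
    linarith
  have hxi : |x i| ≤ T / 2 := by
    have := norm_le_pi_norm x i
    rw [Real.norm_eq_abs] at this
    linarith
  filter_upwards [Metric.ball_mem_nhds x (sub_pos.2 hi)] with y hy
  refine ⟨i, le_abs_sub_mul_int hT hxi ?_⟩
  have := norm_le_pi_norm (y - x) i
  rw [Real.norm_eq_abs, Pi.sub_apply, ← dist_eq_norm] at this
  exact this.trans_lt hy

/-- A `C¹` product cutoff on `ℝⁿ⁺¹`: `χ = 1` on the cube `‖x‖ ≤ a`, `χ = 0` at points with a
coordinate of modulus `≥ b` (in particular where `‖x‖ ≥ b`), and `0 ≤ χ ≤ 1`. -/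
private lemma exists_cutoff {n : ℕ} {a b : ℝ} (ha : 0 < a) (hab : a < b) :
    ∃ χ : (Fin (n + 1) → ℝ) → ℝ, ContDiff ℝ 1 χ ∧ (∀ x, ‖x‖ ≤ a → χ x = 1) ∧
      (∀ x, (∃ i, b ≤ |x i|) → χ x = 0) ∧ (∀ x, b ≤ ‖x‖ → χ x = 0) ∧
      (∀ x, 0 ≤ χ x) ∧ ∀ x, χ x ≤ 1 := by
  let θ : ContDiffBump (0 : ℝ) := ⟨a, b, ha, hab⟩
  have hzero : ∀ x : Fin (n + 1) → ℝ, (∃ i, b ≤ |x i|) → (∏ i, θ (x i)) = 0 := fun x ⟨i, hi⟩ =>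
    Finset.prod_eq_zero (Finset.mem_univ i) (θ.zero_of_le_dist (by simpa [Real.dist_eq] using hi))
  refine ⟨fun x => ∏ i, θ (x i), ?_, ?_, hzero, ?_, ?_, ?_⟩
  · exact contDiff_prod fun i _ => (θ.contDiff (n := 1)).comp (contDiff_apply ℝ ℝ i)
  · intro x hx
    refine Finset.prod_eq_one fun i _ => θ.one_of_mem_closedBall ?_
    have := norm_le_pi_norm x i
    rw [Real.norm_eq_abs] at this
    simpa [Real.dist_eq] using this.trans hx
  · intro x hx
    refine hzero x ?_
    by_contra h
    push Not at h
    have : ‖x‖ < b := (pi_norm_lt_iff (ha.trans hab)).2 fun i => by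
      rw [Real.norm_eq_abs]; exact h i
    linarith
  · exact fun x => Finset.prod_nonneg fun i _ => θ.nonneg
  · exact fun x => Finset.prod_le_one (fun i _ => θ.nonneg) fun i _ => θ.le_one

/-- A continuous field without zeros on the closed cube `‖x‖ ≤ ρ` is bounded away from zero on a
slightly larger closed cube (compactness and a closed thickening). -/
private lemma exists_radius_norm_le {n : ℕ} {ρ : ℝ} (hρ : 0 < ρ)
    {G : (Fin (n + 1) → ℝ) → Fin (n + 1) → ℝ} (hG : Continuous G)
    (hne : ∀ x, ‖x‖ ≤ ρ → G x ≠ 0) :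
    ∃ ρ', ρ < ρ' ∧ ∃ m, 0 < m ∧ ∀ x, ‖x‖ ≤ ρ' → m ≤ ‖G x‖ := by
  have hK : IsCompact (closedBall (0 : Fin (n + 1) → ℝ) ρ) := isCompact_closedBall 0 ρ
  obtain ⟨x₀, hx₀, hmin⟩ :=
    hK.exists_isMinOn (nonempty_closedBall.2 hρ.le) hG.norm.continuousOn
  have hm : 0 < ‖G x₀‖ := norm_pos_iff.2 (hne x₀ (mem_closedBall_zero_iff.1 hx₀))
  have hU : IsOpen {x | ‖G x₀‖ / 2 < ‖G x‖} := isOpen_lt continuous_const hG.norm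
  have hsub : closedBall (0 : Fin (n + 1) → ℝ) ρ ⊆ {x | ‖G x₀‖ / 2 < ‖G x‖} := fun x hx => by
    have h := isMinOn_iff.1 hmin x hx
    rw [mem_setOf_eq]
    linarith
  obtain ⟨δ, hδ, hthick⟩ := hK.exists_cthickening_subset_open hU hsub
  rw [cthickening_closedBall hδ.le hρ.le] at hthick
  refine ⟨δ + ρ, by linarith, ‖G x₀‖ / 2, by positivity, fun x hx => ?_⟩
  exact le_of_lt (hthick (mem_closedBall_zero_iff.2 hx))

/-- **K5 — comparison of signed zero counts.** Let `G₁ G₂ : ℝⁿ⁺¹ → ℝⁿ⁺¹` (sup norm) be `C¹`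
fields with `G₁ = G₂` wherever `‖x‖ ≥ ρ₁`, such that `G₂` has no zero in the closed cube
`‖x‖ ≤ ρ₁` and every zero of `G₁` in that cube is non-degenerate, and let `S` be the finset of
zeros of `G₁` in the open cube `‖x‖ < ρ₁`. Then `∑_{z ∈ S} sign det DG₁(z) = 0`: the Brouwer
degree of `G₁` on the cube equals that of `G₂` (same boundary values), which is `0`. Proof: glue
both fields to the periodic sine field, shift by a small common regular value away from the small
cube, and subtract the two flat-torus index identities; see the module docstring. -/
theorem helper_kronecker_compare :
    ∀ (n : ℕ) (ρ₁ : ℝ) (G₁ G₂ : (Fin (n + 1) → ℝ) → (Fin (n + 1) → ℝ))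
      (S : Finset (Fin (n + 1) → ℝ)),
      0 < ρ₁ → ContDiff ℝ 1 G₁ → ContDiff ℝ 1 G₂ →
      (∀ x : Fin (n + 1) → ℝ, ρ₁ ≤ ‖x‖ → G₁ x = G₂ x) →
      (∀ x : Fin (n + 1) → ℝ, ‖x‖ ≤ ρ₁ → G₂ x ≠ 0) →
      (∀ x : Fin (n + 1) → ℝ, ‖x‖ ≤ ρ₁ → G₁ x = 0 → (fderiv ℝ G₁ x).det ≠ 0) →
      (∀ x : Fin (n + 1) → ℝ, x ∈ S ↔ ‖x‖ < ρ₁ ∧ G₁ x = 0) →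
      ∑ x ∈ S, Real.sign (fderiv ℝ G₁ x).det = 0 := by
  intro n ρ₁ G₁ G₂ S hρ₁ hG₁ hG₂ hagree hG₂ne hG₁nd hS
  classical
  -- a slightly larger cube on which `G₂` stays away from zero; the radii and the period
  obtain ⟨ρ₂, hρ₁₂, m, hm, hG₂m⟩ := exists_radius_norm_le hρ₁ hG₂.continuous hG₂ne
  have hρ₂ : 0 < ρ₂ := hρ₁.trans hρ₁₂
  set ρ₃ : ℝ := ρ₂ + 1 with hρ₃def
  have hρ₂₃ : ρ₂ < ρ₃ := by rw [hρ₃def]; linarith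
  set T : ℝ := 4 * ρ₃ with hTdef
  have hT : 0 < T := by rw [hTdef]; linarith
  have hT0 : T ≠ 0 := hT.ne'
  have hT2 : ρ₃ < T / 2 := by rw [hTdef]; linarith
  have hρ₂T : ρ₂ < T / 2 := hρ₂₃.trans hT2
  have hρ₁T : ρ₁ < T / 2 := hρ₁₂.trans hρ₂T
  -- the two cutoffs
  obtain ⟨χ, hχ_smooth, hχ_one, hχ_zero, -, -, -⟩ := exists_cutoff (n := n) hρ₂ hρ₂₃
  obtain ⟨χ₂, hχ₂_smooth, hχ₂_one, hχ₂_zero, hχ₂_zero', hχ₂_nonneg, hχ₂_le⟩ :=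
    exists_cutoff (n := n) hρ₁ hρ₁₂
  -- the sine field, the glue and its periodisation
  set Sf : (Fin (n + 1) → ℝ) → Fin (n + 1) → ℝ :=
    fun x i => T / (2 * π) * Real.sin (2 * π * x i / T) with hSfdef
  set gof : ((Fin (n + 1) → ℝ) → Fin (n + 1) → ℝ) → (Fin (n + 1) → ℝ) → Fin (n + 1) → ℝ :=
    fun G x => χ x • (G x - Sf x) with hgofdef
  set Hof : ((Fin (n + 1) → ℝ) → Fin (n + 1) → ℝ) → (Fin (n + 1) → ℝ) → Fin (n + 1) → ℝ :=
    fun G x => Sf x + gof G (x - fun l => T * (round (x l / T) : ℝ)) with hHofdef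
  have hSf_smooth : ContDiff ℝ 1 Sf := contDiff_sineField T
  have hgof_smooth : ∀ G, ContDiff ℝ 1 G → ContDiff ℝ 1 (gof G) := fun G hG =>
    hχ_smooth.smul (hG.sub hSf_smooth)
  have hgof_supp : ∀ G x, (∃ i, ρ₃ ≤ |x i|) → gof G x = 0 := fun G x hx => by
    simp only [hgofdef, hχ_zero x hx, zero_smul]
  have hHof_smooth : ∀ G, ContDiff ℝ 1 G → ContDiff ℝ 1 (Hof G) := fun G hG =>
    hSf_smooth.add (contDiff_comp_sub_round hT hT2 (hgof_smooth G hG) (hgof_supp G))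
  have hHof_per : ∀ G x i, Hof G (x + Pi.single i T) = Hof G x := fun G x i => by
    simp only [hHofdef]
    rw [comp_sub_round_add_single hT0 (gof G) x i]
    congr 1
    exact sineField_add_single hT0 x i
  -- on the half-open period cell the periodisation is the identity
  have hsub0 : ∀ x : Fin (n + 1) → ℝ, (∀ i, x i ∈ Ico (-(T / 2)) (T / 2)) →
      (x - fun l => T * (round (x l / T) : ℝ)) = x := fun x hx =>
    comp_sub_round_of_mem_Ico hT id hx
  have hHof_cell : ∀ G x, (∀ i, x i ∈ Ico (-(T / 2)) (T / 2)) →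
      Hof G x = χ x • G x + (1 - χ x) • Sf x := fun G x hx => by
    simp only [hHofdef, hgofdef, hsub0 x hx]
    simp only [smul_sub, sub_smul, one_smul]
    abel
  -- the compact collar-to-cell region and the small common regular value
  set K : Set (Fin (n + 1) → ℝ) := {x | ρ₂ ≤ ‖x‖ ∧ ‖x‖ ≤ T / 2} with hKdef
  have hK : IsCompact K := by
    refine (isCompact_closedBall (0 : Fin (n + 1) → ℝ) (T / 2)).of_isClosed_subset ?_
      fun x hx => mem_closedBall_zero_iff.2 hx.2
    rw [hKdef, setOf_and]
    exact (isClosed_le continuous_const continuous_norm).inter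
      (isClosed_le continuous_norm continuous_const)
  obtain ⟨c, hc, hreg₁, hreg₂⟩ := helper_kronecker_regularValue n (Hof G₁) (Hof G₂) K m
    (hHof_smooth G₁ hG₁) (hHof_smooth G₂ hG₂) hK hm
  -- the shifted periodic fields
  set fof : ((Fin (n + 1) → ℝ) → Fin (n + 1) → ℝ) → (Fin (n + 1) → ℝ) → Fin (n + 1) → ℝ :=
    fun G y => Hof G y - (1 - χ₂ (y - fun l => T * (round (y l / T) : ℝ))) • c with hfofdef
  have hfof_smooth : ∀ G, ContDiff ℝ 1 G → ContDiff ℝ 1 (fof G) := fun G hG =>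
    (hHof_smooth G hG).sub ((contDiff_const.sub
      (contDiff_comp_sub_round hT hρ₂T hχ₂_smooth hχ₂_zero)).smul contDiff_const)
  have hfof_per : ∀ G x i, fof G (x + Pi.single i T) = fof G x := fun G x i => by
    simp only [hfofdef]
    rw [hHof_per G x i, comp_sub_round_add_single hT0 χ₂ x i]
  -- the cell and the sup norm
  have hcellT : ∀ x : Fin (n + 1) → ℝ, (∀ i, x i ∈ Ico (-(T / 2)) (T / 2)) → ‖x‖ ≤ T / 2 :=
    fun x hx => (pi_norm_le_iff_of_nonneg (half_pos hT).le).2 fun i => by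
      obtain ⟨h1, h2⟩ := hx i
      rw [Real.norm_eq_abs, abs_le]
      exact ⟨h1, h2.le⟩
  have hcell_of_lt : ∀ x : Fin (n + 1) → ℝ, ‖x‖ < T / 2 → ∀ i, x i ∈ Ico (-(T / 2)) (T / 2) :=
    fun x hx i => by
      have h := norm_le_pi_norm x i
      rw [Real.norm_eq_abs] at h
      have h' := abs_lt.1 (h.trans_lt hx)
      exact ⟨h'.1.le, h'.2⟩
  -- the values of `fof G` in the cell: small cube, collar, outer region
  have hf_cell : ∀ G x, (∀ i, x i ∈ Ico (-(T / 2)) (T / 2)) →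
      fof G x = χ x • G x + (1 - χ x) • Sf x - (1 - χ₂ x) • c := fun G x hx => by
    simp only [hfofdef, hHof_cell G x hx, hsub0 x hx]
  have hf_in : ∀ G x, ‖x‖ < ρ₁ → fof G x = G x := fun G x hx => by
    rw [hf_cell G x (hcell_of_lt x (hx.trans hρ₁T)), hχ_one x (by linarith), hχ₂_one x hx.le]
    simp
  have hf_mid : ∀ G x, (∀ i, x i ∈ Ico (-(T / 2)) (T / 2)) → ‖x‖ ≤ ρ₂ → m ≤ ‖G x‖ →
      fof G x ≠ 0 := fun G x hx h2 hGx h0 => by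
    rw [hf_cell G x hx, hχ_one x h2] at h0
    simp only [one_smul, sub_self, zero_smul, add_zero] at h0
    have h0' : G x = (1 - χ₂ x) • c := sub_eq_zero.1 h0
    have hle : ‖G x‖ ≤ ‖c‖ := by
      rw [h0', norm_smul, Real.norm_eq_abs]
      refine mul_le_of_le_one_left (norm_nonneg c) (abs_le.2 ⟨?_, ?_⟩)
      · linarith [hχ₂_le x]
      · linarith [hχ₂_nonneg x]
    linarith
  have hf_out : ∀ G x, (∀ i, x i ∈ Ico (-(T / 2)) (T / 2)) → ρ₂ ≤ ‖x‖ →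
      fof G x = Hof G x - c := fun G x hx h => by
    simp only [hfofdef, hsub0 x hx, hχ₂_zero' x h, sub_zero, one_smul]
  have hH_eq : ∀ x, (∀ i, x i ∈ Ico (-(T / 2)) (T / 2)) → ρ₁ ≤ ‖x‖ → Hof G₁ x = Hof G₂ x :=
    fun x hx h => by rw [hHof_cell G₁ x hx, hHof_cell G₂ x hx, hagree x h]
  -- local versions: near the small cube `fof G = G`; far from it, no cutoff and `H₁ = H₂`
  have hf_ev_in : ∀ G z, ‖z‖ < ρ₁ → fof G =ᶠ[𝓝 z] G := fun G z hz => by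
    filter_upwards [Metric.isOpen_ball.mem_nhds (mem_ball_zero_iff.2 hz)] with y hy
    exact hf_in G y (mem_ball_zero_iff.1 hy)
  have hfar : ∀ x, ‖x‖ ≤ T / 2 → ρ₂ < ‖x‖ → ∀ᶠ y in 𝓝 x,
      χ₂ (y - fun l => T * (round (y l / T) : ℝ)) = 0 ∧ Hof G₁ y = Hof G₂ y := fun x hxT hx => by
    filter_upwards [eventually_far hT hρ₂.le hxT hx] with y hy
    refine ⟨comp_sub_round_eq_zero χ₂ hχ₂_zero hy, ?_⟩
    have hd : ∀ w : Fin (n + 1) → ℝ, (∃ i, ρ₂ ≤ |w i|) →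
        (fun w => gof G₁ w - gof G₂ w) w = 0 := by
      rintro w ⟨i, hi⟩
      have hw : ρ₁ ≤ ‖w‖ := by
        have := norm_le_pi_norm w i
        rw [Real.norm_eq_abs] at this
        linarith
      simp only [hgofdef, hagree w hw, sub_self]
    have h := comp_sub_round_eq_zero (fun w => gof G₁ w - gof G₂ w) hd hy
    simp only [sub_eq_zero] at h
    simp only [hHofdef, h]
  have hf_ev_out : ∀ G x, ‖x‖ ≤ T / 2 → ρ₂ < ‖x‖ →
      fof G =ᶠ[𝓝 x] fun y => Hof G y - c := fun G x hxT hx => by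
    filter_upwards [hfar x hxT hx] with y hy
    simp only [hfofdef, hy.1, sub_zero, one_smul]
  have hf_ev_eq : ∀ x, ‖x‖ ≤ T / 2 → ρ₂ < ‖x‖ → fof G₁ =ᶠ[𝓝 x] fof G₂ := fun x hxT hx => by
    filter_upwards [hfar x hxT hx] with y hy
    simp only [hfofdef, hy.2]
  -- the common outer zeros: a finite set by K3
  have hfin : {x ∈ K | Hof G₁ x = c}.Finite :=
    helper_kronecker_finiteZeros n (Hof G₁) K c (hHof_smooth G₁ hG₁) hK hreg₁
  set Zout : Finset (Fin (n + 1) → ℝ) := hfin.toFinset.filter fun x => ∀ i, x i < T / 2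
    with hZoutdef
  have hmem_Zout : ∀ x, x ∈ Zout ↔
      (ρ₂ ≤ ‖x‖ ∧ ‖x‖ ≤ T / 2) ∧ Hof G₁ x = c ∧ ∀ i, x i < T / 2 := fun x => by
    simp only [hZoutdef, Finset.mem_filter, Set.Finite.mem_toFinset, mem_setOf_eq, hKdef,
      and_assoc]
  have hZout_cell : ∀ x ∈ Zout, (∀ i, x i ∈ Ico (-(T / 2)) (T / 2)) ∧ ρ₂ < ‖x‖ := by
    intro x hx
    obtain ⟨⟨h1, h2⟩, hHc, h3⟩ := (hmem_Zout x).1 hx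
    have hcell : ∀ i, x i ∈ Ico (-(T / 2)) (T / 2) := fun i => by
      have h := norm_le_pi_norm x i
      rw [Real.norm_eq_abs] at h
      exact ⟨(abs_le.1 (h.trans h2)).1, h3 i⟩
    refine ⟨hcell, lt_of_le_of_ne h1 fun heq => ?_⟩
    have h0 : fof G₁ x = 0 := by rw [hf_out G₁ x hcell h1, hHc, sub_self]
    have hGx : m ≤ ‖G₁ x‖ := by
      rw [hagree x (hρ₁₂.le.trans h1)]
      exact hG₂m x heq.symm.le
    exact hf_mid G₁ x hcell heq.symm.le hGx h0
  -- the zero sets of `f₁` and `f₂` in the half-open cell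
  have hTT : -(T / 2) + T = T / 2 := by ring
  have hchar₁ : ∀ x, x ∈ S ∪ Zout ↔
      (∀ i, x i ∈ Ico (-(T / 2)) (-(T / 2) + T)) ∧ fof G₁ x = 0 := by
    intro x
    simp only [hTT, Finset.mem_union]
    constructor
    · rintro (hx | hx)
      · obtain ⟨hxρ, hx0⟩ := (hS x).1 hx
        exact ⟨hcell_of_lt x (hxρ.trans hρ₁T), by rw [hf_in G₁ x hxρ, hx0]⟩
      · obtain ⟨hcell, hxρ⟩ := hZout_cell x hx
        refine ⟨hcell, ?_⟩
        rw [hf_out G₁ x hcell hxρ.le, ((hmem_Zout x).1 hx).2.1, sub_self]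
    · rintro ⟨hcell, h0⟩
      rcases lt_or_ge ‖x‖ ρ₁ with h1 | h1
      · left
        exact (hS x).2 ⟨h1, by rwa [hf_in G₁ x h1] at h0⟩
      · right
        rcases le_or_gt ‖x‖ ρ₂ with h2 | h2
        · have hGx : m ≤ ‖G₁ x‖ := by
            rw [hagree x h1]
            exact hG₂m x h2
          exact absurd h0 (hf_mid G₁ x hcell h2 hGx)
        · refine (hmem_Zout x).2 ⟨⟨h2.le, hcellT x hcell⟩, ?_, fun i => (hcell i).2⟩
          rwa [hf_out G₁ x hcell h2.le, sub_eq_zero] at h0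
  have hchar₂ : ∀ x, x ∈ Zout ↔
      (∀ i, x i ∈ Ico (-(T / 2)) (-(T / 2) + T)) ∧ fof G₂ x = 0 := by
    intro x
    simp only [hTT]
    constructor
    · intro hx
      obtain ⟨hcell, hxρ⟩ := hZout_cell x hx
      refine ⟨hcell, ?_⟩
      rw [hf_out G₂ x hcell hxρ.le, ← hH_eq x hcell (hρ₁₂.le.trans hxρ.le),
        ((hmem_Zout x).1 hx).2.1, sub_self]
    · rintro ⟨hcell, h0⟩
      rcases lt_or_ge ‖x‖ ρ₁ with h1 | h1
      · rw [hf_in G₂ x h1] at h0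
        exact absurd h0 (hG₂ne x h1.le)
      · rcases le_or_gt ‖x‖ ρ₂ with h2 | h2
        · exact absurd h0 (hf_mid G₂ x hcell h2 (hG₂m x h2))
        · refine (hmem_Zout x).2 ⟨⟨h2.le, hcellT x hcell⟩, ?_, fun i => (hcell i).2⟩
          rwa [hf_out G₂ x hcell h2.le, sub_eq_zero, ← hH_eq x hcell h1] at h0
  -- derivatives at the zeros
  have hD_in : ∀ z ∈ S, fderiv ℝ (fof G₁) z = fderiv ℝ G₁ z := fun z hz =>
    (hf_ev_in G₁ z ((hS z).1 hz).1).fderiv_eq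
  have hD_out : ∀ G, ∀ x ∈ Zout, fderiv ℝ (fof G) x = fderiv ℝ (Hof G) x := fun G x hx => by
    obtain ⟨hcell, hxρ⟩ := hZout_cell x hx
    rw [(hf_ev_out G x (hcellT x hcell) hxρ).fderiv_eq, fderiv_sub_const]
  have hD_eq : ∀ x ∈ Zout, fderiv ℝ (fof G₁) x = fderiv ℝ (fof G₂) x := fun x hx => by
    obtain ⟨hcell, hxρ⟩ := hZout_cell x hx
    exact (hf_ev_eq x (hcellT x hcell) hxρ).fderiv_eq
  have hnd₁ : ∀ x ∈ S ∪ Zout, (fderiv ℝ (fof G₁) x).det ≠ 0 := by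
    intro x hx
    rcases Finset.mem_union.1 hx with hx | hx
    · rw [hD_in x hx]
      obtain ⟨h1, h0⟩ := (hS x).1 hx
      exact hG₁nd x h1.le h0
    · rw [hD_out G₁ x hx]
      obtain ⟨hK', hHc, -⟩ := (hmem_Zout x).1 hx
      exact hreg₁ x hK' hHc
  have hnd₂ : ∀ x ∈ Zout, (fderiv ℝ (fof G₂) x).det ≠ 0 := by
    intro x hx
    rw [hD_out G₂ x hx]
    obtain ⟨hK', hHc, -⟩ := (hmem_Zout x).1 hx
    obtain ⟨hcell, hxρ⟩ := hZout_cell x hx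
    refine hreg₂ x hK' ?_
    rw [← hH_eq x hcell (hρ₁₂.le.trans hxρ.le), hHc]
  -- the two torus identities and their difference
  have key₁ := sum_sign_det_eq_zero_of_periodic hT (fun _ => -(T / 2)) (hfof_smooth G₁ hG₁)
    (hfof_per G₁) (S ∪ Zout) hchar₁ hnd₁
  have key₂ := sum_sign_det_eq_zero_of_periodic hT (fun _ => -(T / 2)) (hfof_smooth G₂ hG₂)
    (hfof_per G₂) Zout hchar₂ hnd₂
  have hdisj : Disjoint S Zout := by
    rw [Finset.disjoint_left]
    intro x hxS hxZ
    have h1 := ((hS x).1 hxS).1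
    have h2 := (hZout_cell x hxZ).2
    linarith
  rw [Finset.sum_union hdisj] at key₁
  have hsumS : ∑ x ∈ S, Real.sign (fderiv ℝ (fof G₁) x).det =
      ∑ x ∈ S, Real.sign (fderiv ℝ G₁ x).det :=
    Finset.sum_congr rfl fun x hx => by rw [hD_in x hx]
  have hsumZ : ∑ x ∈ Zout, Real.sign (fderiv ℝ (fof G₁) x).det =
      ∑ x ∈ Zout, Real.sign (fderiv ℝ (fof G₂) x).det :=
    Finset.sum_congr rfl fun x hx => by rw [hD_eq x hx]
  rw [hsumS, hsumZ, key₂, add_zero] at key₁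
  exact key₁

end Summit.SmoothPoincare4.SmoothPoincare4.Theorems.WitnessCharge.PencilIncompleteness

end
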